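import Mathlib
import HarnessLib
import HarnessLib.Audit
import Summits.PneNP.Statement
import Literature.Computability.MetaComplexity.BoundedArithSyntax
import Literature.Computability.MetaComplexity.BoundedArithTheories

/-!
Route: RootDecompAdviceProvability

DORMANT since 2026-09-04T14:27:30Z (reconciler: no traction for 5 d (last activity statement-checked at 2026-08-30T13:23:22Z); parked, not closed — `ledger route dormant route-PneNP-RootDecompAdviceProvability --off` to reactivate) — unstaffed, not closed; items shared with open routes are served there. `ledger route dormant <id> --off` reactivates.

# Route RootDecompAdviceProvability — Root decomposition on the X-dial of the provability plane at T
= S₂¹ — P = NP forces S₂¹ ⊬ NP ⊆ P/poly (advice form), AND P = NP forces S₂¹ ⊢ NP ⊆ P/poly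

Root-decomposition cell decomp-pnenp, node N12 «X-DIAL OF THE PROVABILITY PLANE at T = S₂¹» (lens-5
gen 4 «AdviceProvabilityCut», HOME/decomp-pnenp-lens-5/AdviceProvabilityCut.lean
sha256 27f516ff…, AdviceProvabilityCut_items.lean 1f3ea9ec… (lens writer-cert, Iff.rfl),
WRITER-NOTE-v4.md; critic decomp-pnenp-crit-1 CLEARED 2026-08-30T04:22:03Z with 0
objection: the generic cut S ⟺ (¬S → Y) ∧ (¬S → ¬Y) along the NEW typed predicate Y = U⁺ = «S₂¹ ⊬ NP
⊆ P/poly in ADVICE FORM (provably-Δᵇ₁ relation + term-bounded advice)»,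
OPEN-NAMED-IN-PRINT, scores ONCE under cap (vii); F1 TREE books it in the N1 family (the (S₂¹, NP ⊆
P/poly) cell of the provability plane whose (S₂¹, P = NP) cell is N1 v3 ≡ N8);
F2 filing W1 = this thin AND-route, preferred by lens and critic; writer certificate
bc/N12_items.lean, every filed statement = the lens statement by `Iff.rfl`). It suffices to
show X = A⁺ ∧ R⁻ with A⁺ = `AdviceDarkForS12` «NP ⊆ P ⟹ S₂¹ does not prove NP ⊆ P/poly in advice
form» (attacked conjunct) and R⁻ = `AdviceCollapseIsProvable` «P = NP ⟹ S₂¹ ⊢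
NP ⊆ P/poly in advice form» (the DECLARED RESIDUAL). The node is the exact carving S ⟺ A⁺ ∧ R⁻
(kernel `summit_iff_split` = lens `node_iff`, hypothesis-free); the S-free ROAD
U⁺ = `NoS12ProofOfNPinPpoly` (INCOMPARABLE with S) and the kernel edge U⁺ ⟹ U (N1's
stmt-PneNP-26831) are filed as asides.
Lean: `(¬ PneNP → ¬ (∀ φ : FirstOrder.Language.boundedArith.Formula (Fin 2),
Literature.Computability.MetaComplexity.IsSigmab 1 φ → ∃ (χ₁ χ₂ :
FirstOrder.Language.boundedArith.Formula (Fin 2)) (t : FirstOrder.Language.boundedArith.Term (Fin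
1)), Literature.Computability.MetaComplexity.IsSigmab 1 χ₁ ∧
Literature.Computability.MetaComplexity.IsPib 1 χ₂ ∧ (Literature.Computability.MetaComplexity.S2 1
⊨ᵇ FirstOrder.Language.BoundedFormula.iff χ₁ χ₂) ∧ (Literature.Computability.MetaComplexity.S2 1 ⊨ᵇ
FirstOrder.Language.BoundedFormula.imp (FirstOrder.Language.Term.le (FirstOrder.Language.Term.var
(Sum.inl 1)) (FirstOrder.Language.Term.var (Sum.inl 0)))
(Literature.Computability.MetaComplexity.bexLE (t.relabel fun _ => (Sum.inl 0 : Fin 2 ⊕ Fin 0))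
(Literature.Computability.MetaComplexity.ballLE (FirstOrder.Language.Term.var (Sum.inl 0))
(FirstOrder.Language.BoundedFormula.iff (FirstOrder.Language.BoundedFormula.relabel ![Sum.inr 1,
Sum.inl 1] φ : FirstOrder.Language.boundedArith.BoundedFormula (Fin 2) 2)
(FirstOrder.Language.BoundedFormula.relabel ![Sum.inr 1, Sum.inr 0] χ₁ :
FirstOrder.Language.boundedArith.BoundedFormula (Fin 2) 2))))))) ∧ (¬ PneNP → (∀ φ :
FirstOrder.Language.boundedArith.Formula (Fin 2), Literature.Computability.MetaComplexity.IsSigmab 1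
φ → ∃ (χ₁ χ₂ : FirstOrder.Language.boundedArith.Formula (Fin 2)) (t :
FirstOrder.Language.boundedArith.Term (Fin 1)), Literature.Computability.MetaComplexity.IsSigmab 1
χ₁ ∧ Literature.Computability.MetaComplexity.IsPib 1 χ₂ ∧
(Literature.Computability.MetaComplexity.S2 1 ⊨ᵇ FirstOrder.Language.BoundedFormula.iff χ₁ χ₂) ∧
(Literature.Computability.MetaComplexity.S2 1 ⊨ᵇ FirstOrder.Language.BoundedFormula.imp
(FirstOrder.Language.Term.le (FirstOrder.Language.Term.var (Sum.inl 1))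
(FirstOrder.Language.Term.var (Sum.inl 0))) (Literature.Computability.MetaComplexity.bexLE
(t.relabel fun _ => (Sum.inl 0 : Fin 2 ⊕ Fin 0)) (Literature.Computability.MetaComplexity.ballLE
(FirstOrder.Language.Term.var (Sum.inl 0)) (FirstOrder.Language.BoundedFormula.iff
(FirstOrder.Language.BoundedFormula.relabel ![Sum.inr 1, Sum.inl 1] φ :
FirstOrder.Language.boundedArith.BoundedFormula (Fin 2) 2)
(FirstOrder.Language.BoundedFormula.relabel ![Sum.inr 1, Sum.inr 0] χ₁ :
FirstOrder.Language.boundedArith.BoundedFormula (Fin 2) 2)))))))`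

## Assembly
Pure logic (kernel `closes`, hypothesis-free, = n12/glue.lean, two lines): assume ¬S; R⁻ gives
ProvNPinPpoly, A⁺ gives its negation — contradiction. Conversely S ⟹ A⁺ and S ⟹ R⁻
(vacuous antecedents), so S ⟺ A⁺ ∧ R⁻ exactly (`summit_iff_split` = lens `node_iff`).

Rationale: WHY THIS LINE. Bounded arithmetic measures the STRENGTH OF THEORY needed to prove complexity
collapses/separations; the literature's «central open question» w.r.t. circuit lower bounds is
whether S₂¹ is consistent with NP ⊄ P/poly [corpus:paper:arxiv-2604.25251 p.3 L27–29
(Atserias–Müller 2026); corpus:paper:arxiv-2303.01016 p.3 L80–81 (Atserias–Buss–Müller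
2023)], i.e. exactly U⁺, with DECIDED neighbouring rungs (V₂⁰ + NEXP ⊄ P/poly consistent, ABM23 p.5;
S₂¹ + EXP ⊄ P/poly consistent via Takeuti, AM26 p.3 L86–88; fixed-k rungs
PV/S₂¹ ⊬ NP ⊆ SIZE[n^k], BKO20 Thm 1 [corpus:paper:arxiv-1905.12935 p.5], KO17; relativised T₂¹(α) ≠
T₂(α), KPT91 doi:10.1016/0168-0072(91)90043-l). The lens types «S₂¹ ⊢ NP ⊆
P/poly» as a Mathlib model-theoretic sentence over the tree's Buss language
(`Literature.Computability.MetaComplexity.S2 1 ⊨ᵇ …`, `IsSigmab` / `IsPib`, `bexLE` / `ballLE`):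
every
Σᵇ₁ formula φ(x,b) has a Σᵇ₁ mate χ₁, provably equivalent to a Πᵇ₁ χ₂ (provably Δᵇ₁ = «P» by Buss
witnessing, reading fact outside the kernel), and a term t with S₂¹ ⊨ᵇ «b ≤ n →
∃ a ≤ t(n) ∀ x ≤ n (φ(x,b) ↔ χ₁(x,a))». The cut along Y = U⁺ is the cell's generic move (N9/N10/N11
precedent) on the proof-complexity axis: A⁺ ⟺ S ∨ U⁺, R⁻ ⟺ S ∨ ¬U⁺ (kernel
`dark_iff_or`, `collapseProvable_iff_or`). What it brings that N1 does not: N1's attacked piece «¬S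
→ U» IS U (U is S-implied), whereas U⁺ is INCOMPARABLE with S (DeMillo–Lipton vs
Karp–Lipton-provable worlds both unexcluded) — a genuinely different position on the X-dial — and
the residual R⁻ is PROVED ≤ N1's residual pair (kernel `collapseProvable_of_record :
ProverIsProvable → CollapseReachesEF → R⁻`, through N1's own closes) with strictness UNDECIDED.
Imported from proof complexity / bounded arithmetic (Buss 1986, Krajicek1995,
Krajicek2019, Cook–Krajíček 2007, ABM23, AM26); no Literature fact rides as a hypothesis in any
item.

RANKED CRUXES. #2 AdviceDarkForS12 (crux) — A⁺ (lens PIECE A⁺, attacked conjunct): if P = NP then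
S₂¹ does NOT prove «NP ⊆ P/poly» in advice form (provably-Δᵇ₁ relation + term-bounded advice) — i.e.
¬S → U⁺ with the sentence ProvNPinPpoly inlined verbatim (Mathlib `⊨ᵇ` over the tree's Buss
language; relabellings `![Sum.inr 1, Sum.inl 1]` = φ's input ↦ bound x, parameter ↦ free b;
`![Sum.inr 1, Sum.inr 0]` = χ₁'s input ↦ x, advice ↦ bound a). Tags (critic 04:22:03Z): WEAKER than
S formally (S ⟹ A⁺ vacuously, kernel `dark_of_summit`), NECESSARY, not COSTUME (A⁺ ⟺ S ∨ U⁺ and U⁺ ⊬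
S, probes fail), not LAW-A, UNDECIDED (strictness world = P = NP ∧ U⁺ = «Con(S₂¹ + NP ⊆ P + S₂¹ ⊬ NP
⊆ P/poly)», the advice-scheme DeMillo–Lipton world; only the uniform fixed-algorithm version in
print, BKO20 App. A [corpus:paper:arxiv-1905.12935 p.16]); S-free ROAD U⁺ ⟹ A⁺ (kernel
`dark_of_road`; aside NoS12ProofOfNPinPpoly); ABOVE N1's U modulo N1's necessity edge S ⟹ U (kernel
`u_of_dark`); leaf IDEA-NEEDED · LOCATED (AM26's central open question) · PROGRAM-BACKED
(ABM23/AM26/BKO20/CLO24 unprovability programme). BC5 rung PLAN-ONLY: the decided rung (S₂¹, EXP) of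
Y's lattice [AM26 p.3 L86–88] needs definition request D1 (bussCircuitEval) to be typed; D2 =
defn-RelativizedBoundedArith (filed) types the TRUE relativised rung T₂¹(α) ≠ T₂(α) (KPT91).
[difficulty: open-problem] (why it might fail: P = NP may hold with an algorithm whose correctness
AND polynomial-size circuits S₂¹ certifies (a Karp–Lipton-provable world): then ¬U⁺, A⁺ fails and R⁻
⟺ S; no model of S₂¹ + P = NP + «S₂¹ ⊬ NP ⊆ P/poly» is known even for the uniform version beyond
fixed algorithms (BKO20 App. A).) [arXiv:2604.25251, arXiv:2303.01016, arXiv:1905.12935,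
Krajicek1995, Krajicek2019, doi:10.1016/0168-0072(91)90043-l]
#3 AdviceCollapseIsProvable (crux) — R⁻ (lens PIECE R⁻, the DECLARED RESIDUAL): if P = NP then S₂¹
PROVES «NP ⊆ P/poly» in advice form (provably-Δᵇ₁ relation + term-bounded advice) — ¬S →
ProvNPinPpoly, verbatim. Tags: DECLARED-RESIDUAL · S-implied (law D recorded, not hidden: kernel
`collapseProvable_of_summit`) · «≤ N1's residual pair» PROVED in kernel (`collapseProvable_of_record
: ProverIsProvable (stmt-PneNP-26832) → CollapseReachesEF (stmt-PneNP-17354) → R⁻`, and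
`AdviceCollapseIsProvable_of : (U → S) → R⁻` = the BC3 strengthen-to-record line) · converse UNKNOWN
(S₂¹ ⊢ NP ⊆ P/poly gives PH ⊆ P^NP_tt by Cook–Krajíček 2007 doi:10.2178/jsl/1203350791 but no
S₂¹-certified SAT algorithm) ⇒ critic rule (v): BOOKED «residual candidate of the proof-complexity
chain: ≤ proved, < undecided» (stated test: «S₂¹ ⊢ NP ⊆ P/poly ⟹ ∃ e k, S₂¹ ⊢ Dec(e,k)?»; becomes
the chain's residual of record on a separating-world note from the census, else stays tied with N1's
pair); zero-sum honesty: given U⁺, R⁻ ⟺ S; given ¬U⁺, A⁺ ⟺ S (lens probes R_is_S_given_Up /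
A_is_S_given_notUp). [deps: AdviceDarkForS12] [difficulty: open-problem] (why it might fail: Cannot
fail more than N1's residual pair does (kernel edge); stand-alone it asserts that EVERY P = NP world
is Karp–Lipton-provable in S₂¹ — false in any DeMillo–Lipton-type model of S₂¹ + P = NP + ¬«NP ⊆
P/poly provably», none known (BKO20 App. A has only the fixed-algorithm uniform version).)
[arXiv:1905.12935, doi:10.2178/jsl/1203350791, Krajicek1995, arXiv:2604.25251]
#9 NoS12ProofOfNPinPpoly (support) — (filed kind ASIDE — the ROAD U⁺, INCOMPARABLE with S (probes U⁺
→ S and S → U⁺ fail; precedents N7-26297, lens-4 τ-road), never in the cone of `closes` until a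
registered skeleton of A⁺ names it as stub) «S₂¹ does not prove NP ⊆ P/poly in advice form
(provably-Δᵇ₁ relation + term-bounded advice)» = ¬ProvNPinPpoly — the literature's central open
question of bounded arithmetic w.r.t. circuit lower bounds [corpus:paper:arxiv-2604.25251 p.3
L27–29; corpus:paper:arxiv-2303.01016 p.3]; U⁺ ⟹ A⁺ (kernel `dark_of_road`), U⁺ ∧ R⁻ ⟹ S
(`closes_of_road`); decided rungs of Y's lattice in print: (V₂⁰, NEXP) ABM23, (S₂¹, EXP) AM26 via
Takeuti, fixed-k BKO20/KO17, relativised KPT91 TRUE; in-print meta-ceiling «Gödel-type consistency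
statements do not seem to reach very far … new methods seem to be required»
[corpus:paper:arxiv-2604.25251 p.3 L52–57]; every other printed road to U⁺ (NP ⊄ P/poly, PH ⊄
P^NP_tt, coNP ⊄ NP/O(log n)) is ≥ S. Kill = a proof of ProvNPinPpoly. One click further (record
only, not filed): U⁺⁺ «S₂¹ ⊬ NP ⊆ coNP/poly» with kernel U⁺⁺ ⟹ U⁺ (lens Part IV); top calibration
«S₂¹ ⊢ NP ⊆ NP/poly» PROVED in kernel (lens `provNPinNPpoly_holds`). [difficulty: open-problem]
[arXiv:2604.25251, arXiv:2303.01016, arXiv:1905.12935, doi:10.1016/0168-0072(91)90043-l]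
#9 UPlusImpliesU (support) — (filed kind ASIDE, SUPPORT-DESIGNATE, PROVABLE NOW — kernel
`uPlusImpliesU_holds` in bc/N12_items.lean = lens `noS12ProofOfNPeqCoNP_of_uPlus`, ~15 lines:
provable NP = coNP ⟹ provable NP ⊆ P/poly with empty advice; the dummy bounded parameter b ≤ n makes
the edge relabel-free) the edge placing the road under N1: U⁺ ⟹ U, where U = stmt-PneNP-26831
NoS12ProofOfNPeqCoNP «S₂¹ ⊬ NP = coNP» (text verbatim = route-PneNP-RootDecompEfProver decl,
certified `u_text_iff_tree : … := Iff.rfl`). Port target: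
Theorems/RootDecompAdviceProvability/UPlusImpliesU.lean by any idle prover. [difficulty:
provable-now] [Krajicek1995, arXiv:2604.25251]

TWO-LAYER PLAN. Foreseen, NOT filed now: A⁺ ⇐ U⁺ (the road; kernel `dark_of_road`) ⇐ a
consistency/forcing construction for S₂¹ + NP ⊄ P/poly (advice form) — honest statement (lens §4):
A⁺'s only
S-free plan IS the road, so a 2-stub skeleton would be U⁺ := (T₂¹ ≠ T₂-typed statement) ∧ (that ⟹
U⁺) once definition debts D1/D2 land (BC3 PLAN-ONLY); R⁻ ⇐ S12Lift (U → S) ⇐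
ProverIsProvable ∧ CollapseReachesEF (N1, by name; kernel `AdviceCollapseIsProvable_of`,
`collapseProvable_of_record`). Census test for R⁻'s strictness: a world with P = NP,
S₂¹ ⊢ NP ⊆ P/poly and S₂¹ ⊬ NP = coNP.

KILL CRITERIA. A refutation of AdviceDarkForS12 or of AdviceCollapseIsProvable refutes P ≠ NP itself
(both are kernel consequences of S) — the route then closes with the summit. A proof of
ProvNPinPpoly («S₂¹ ⊢ NP ⊆ P/poly», advice form) kills the ROAD U⁺ and makes A⁺ ⟺ S, R⁻ a theorem:
the node is spent (zero-sum recorded at birth). A proof of U⁺ proves A⁺ outright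
and hands S back as R⁻ (then R⁻ ⟺ S). A proof of N1's residual pair (26832 ∧ 17354) proves R⁻ by
name.

NOT DECOMPOSED YET. The circuit form of U⁺ and its equivalence with the advice form (needs D1
bussCircuitEval; reading facts F-a Cook–Levin in S₂¹, F-b Buss witnessing, F-c PV ⊢ P ⊆ P/poly stay
outside
the kernel and are named in the docstrings, critic F3); the relativised rung (needs D2); the U⁺⁺ =
coNP/poly click and the (S₂¹, PSPACE) question (AM26 p.22) — dial positions,
recorded not scored; Cook–Krajíček 2007 exact statements UNVERIFIED (source not held, lit want
acq-14853) — used only as quoted by ABM23 p.4 / Krajíček 2019 p.475.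

CHEAPEST FALSIFIER. Lookups (lens 04:1xZ, critic-verified 04:22:03Z): is «S₂¹ ⊢ NP ⊆ P/poly» refuted
or proved in print, or is Con(S₂¹ + NP ⊆ P + S₂¹ ⊬ NP ⊆ P/poly) known? — ABM23 p.3 L80–81 «it is
unknown whether NP ⊄ P/poly is consistent with S₂¹»; AM26 p.3 L27–29 «the central open question»;
BKO20 App. A only the fixed-algorithm uniform version ⇒ U⁺ OPEN-NAMED, A⁺/R⁻
UNDECIDED. In-tree: `lean search` finds no decl stating S₂¹ ⊬ NP ⊆ P/poly; nearest items 26831 (U,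
uniform, BELOW by kernel edge), 17354/17355 FeasibleWitnessing (EF-simulation,
different object); ledger negatives --problem PneNP: none of the item texts matches.
Degenerate-witness audit (lens Part V): the advice clause is satisfiable as typed
(`ppolyData_of_isSharplyBounded`, `adviceClause_self`), so U⁺ is not true by a typo and ¬U⁺ does not
fail for plumbing reasons.

NUMBERS. X-dial at T = S₂¹ (statement strength X ↦ «S₂¹ ⊬ X»): X = «P = NP» — N1 v3 ≡ N8 (U = 26831,
S-implied); X = «NP ⊆ P/poly» (advice form) — THIS NODE (U⁺ incomparable with S;
OPEN-NAMED); X = «NP ⊆ coNP/poly» — U⁺⁺ record (U⁺⁺ ⟹ U⁺ kernel); X = «NP ⊆ NP/poly» — top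
calibration, ¬(S₂¹ ⊬ X) PROVED in kernel (costume end). T-dial (theory strength) =
lens-6 g3 ProvabilityDial, merged into N1 (critic 03:25:15Z). Decided rungs in print: (V₂⁰, NEXP ⊄
P/poly) consistent [ABM23 p.5 L129]; (S₂¹, EXP ⊄ P/poly) consistent [AM26 p.3
L86–88]; PV/S₂¹(+true Π) ⊬ NP ⊆ SIZE[n^k] for each fixed k [BKO20 Thm 1 p.5]; T₂¹(α) ≠ T₂(α)
[KPT91].

DEFINITION REQUESTS. D1 `bussCircuitEval` (Literature/Computability/MetaComplexity): arithmetised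
Boolean-circuit evaluation as a Δᵇ₁ formula of Buss's language with PV-provable basic clauses —
unlocks the circuit form of U⁺, its equivalence with the advice form, and the kernel rungs
«S₂¹(+true Π) ⊬ NP ⊆ SIZE[n^k]» (to be filed `ledger workitem add --kind definition
--notion bussCircuitEval --topic Literature/Computability/MetaComplexity` for AdviceDarkForS12). D2
= defn-RelativizedBoundedArith (ALREADY FILED by the writer for N1's U; also
types U⁺'s relativised rung). Acquisition of record: acq-14853 (Cook–Krajíček 2007, JSL 72(4)).

Novelty: Searches (2026-08-30, lens-5 g4 + critic + writer): lit search --hybrid "S^1_2 consistent NP not in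
P/poly" / "bounded arithmetic unprovability circuit lower bounds" (hits: arXiv:2604.25251
Atserias–Müller 2026 pp.3/22, arXiv:2303.01016 ABM23 pp.3–6, arXiv:1905.12935 BKO20 pp.5/16,
arXiv:2404.11841 p.13, arXiv:2504.04416 Oliveira survey pp.15–16); lit galaxy search "bounded
arithmetic|P/poly|unprovability" --star all and --star panama title "Bounded Arithmetic" (Krajíček
1995 [galaxy:panama], Krajíček 2019 p.475 [galaxy:panama:215590178390025]); lit citing
doi:10.2178/jsl/1203350791 (Cook–Krajíček 2007; not held, acq-14853); in-tree `lean search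
'NoS12Proof|ProvNP|Ppoly'` (only N1's 26831 and FeasibleWitnessing 17354/17355); ledger negatives
--problem PneNP (no match).
Nearest prior art found: arXiv:2604.25251 (AM26: names U⁺ as the central open question; proves the
(S₂¹, EXP) rung), arXiv:2303.01016 (ABM23: V₂⁰ rungs), arXiv:1905.12935 (BKO20: fixed-k rungs, App.
A uniform DeMillo–Lipton-type consistency), doi:10.1016/0168-0072(91)90043-l (KPT91 relativised
rung), in-tree route-PneNP-RootDecompEfProver (N1: the (S₂¹, P = NP) cell; U = 26831).
Delta: the first decomposition of P ≠ NP cut along the UNPROVABILITY-OF-NONUNIFORM-COLLAPSE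
predicate «S₂¹ ⊬ NP ⊆ P/poly», typed in kernel as a model-theoretic sentence, with the road
incomparable with S, the residual proved below N1's residual pair, and the dial's top calibration
decided in kernel.
Claimed grade: new-combination  [refs: 10.2178/jsl/1203350791, 10.1016/0168-0072(91, 2604.25251, 2303.01016, 1905.12935, 2404.11841, 2504.04416, doi:10.2178/jsl/1203350791, doi:10.1016/0168-0072]

Barriers (technique_class: proof-complexity, bounded-arithmetic, law-D-carving): - technique_class: proof-complexity, bounded-arithmetic, law-D-carving
- Literature.Barriers.PneNP.Relativization: OUTSIDE — A⁺, R⁻, U⁺ are statements about PROVABILITY IN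
S₂¹, over which BGS does not quantify; relativised versions A⁺(α)/U⁺(α) are TRUE (KPT91: T₂¹(α) ≠
T₂(α)) and no contrary oracle world exists because S₂¹(α) has no oracle axioms ⇒ relativization
gives neither obstruction nor evidence (PRICED-BY-ABSENCE, critic rule (vi) accepted 04:22:03Z).
- Literature.Barriers.PneNP.BoundedRelativization: OUTSIDE for the same reason — no bounded-oracle
separation of classes is claimed; the items are unprovability / provability statements.
- Literature.Barriers.PneNP.Algebrization: OUTSIDE — AW quantifies over algebrizing
inclusions/separations of complexity classes, not over «S₂¹ ⊬ X»; undefined for the implication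
pieces.
- Literature.Barriers.PneNP.NaturalProofs: does not parse for A⁺/R⁻/U⁺ (no explicit circuit lower
bound is claimed); RR97 prices only the ≥ S road to U⁺ via explicit lower bounds NP ⊄ P/poly, which
the route does not take.
- Literature.Barriers.PneNP.FeasibleInterpolationEF: one level down (propositional EF, KP98 under
RSA) — bites the interpolation sub-road of N1's A, not the S₂¹-unprovability road here; the in-print
META-CEILING that does apply is AM26 p.3 L52–57 «Gödel-type consistency statements do not seem to
reach very far … new methods seem to be required» — priced honestly as the road's ceiling (bc9), not
a catalogued barrier.
- Literature.Barrie

History (route lifecycle, newest last):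
- 2026-09-04T14:27:30Z · DORMANT — reconciler: no traction for 5 d (last activity statement-checked at 2026-08-30T13:23:22Z); parked, not closed — `ledger route dormant route-PneNP-RootDecompAdvi (operator:999:960552)

sub-problem: PneNP · status: dormant · opened planner-decomp-pnenp-writer-1-g3-0 2026-08-30T04:49:40Z · rev 2 · ledger route-PneNP-RootDecompAdviceProvability
GENERATED by the gate from the ledger (D-0016/17). Provers cite these decls: `theorem foo : Summit.PneNP.PneNP.Theses.RootDecompAdviceProvability.<Decl> := …` in Summits/PneNP/PneNP/Theorems/<Name>.lean.
-/

namespace Summit.PneNP.PneNP.Theses.RootDecompAdviceProvability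

open scoped BigOperators Topology Manifold Classical MeasureTheory ProbabilityTheory Matrix InnerProductSpace ComplexConjugate ContinuousMap
open Filter Set Function TopologicalSpace MeasureTheory

attribute [summit_statement] _root_.PneNP

open Literature.PNP

/-- item stmt-PneNP-28070 · crux · rank 2 · open · by planner
why it might fail: P = NP may hold with an algorithm whose correctness AND polynomial-size circuits S₂¹ certifies (a Karp–Lipton-provable world): then ¬U⁺, A⁺ fails and R⁻ ⟺ S; no model of S₂¹ + P = NP + «S₂¹ ⊬ NP ⊆ P/poly» is known even for the uniform version beyond fixed algorithms (BKO20 App. A).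
sources: arXiv:2604.25251, arXiv:2303.01016, arXiv:1905.12935, Krajicek1995, Krajicek2019, doi:10.1016/0168-0072(91)90043-l
[crux] A⁺ (lens PIECE A⁺, attacked conjunct): if P = NP then S₂¹ does NOT prove «NP ⊆ P/poly» in
advice form (provably-Δᵇ₁ relation + term-bounded advice) — i.e. ¬S → U⁺ with the sentence
ProvNPinPpoly inlined verbatim (Mathlib `⊨ᵇ` over the tree's Buss language; relabellings `![Sum.inr
1, Sum.inl 1]` = φ's input ↦ bound x, parameter ↦ free b; `![Sum.inr 1, Sum.inr 0]` = χ₁'s input ↦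
x, advice ↦ bound a). Tags (critic 04:22:03Z): WEAKER than S formally (S ⟹ A⁺ vacuously, kernel
`dark_of_summit`), NECESSARY, not COSTUME (A⁺ ⟺ S ∨ U⁺ and U⁺ ⊬ S, probes fail), not LAW-A,
UNDECIDED (strictness world = P = NP ∧ U⁺ = «Con(S₂¹ + NP ⊆ P + S₂¹ ⊬ NP ⊆ P/poly)», the
advice-scheme DeMillo–Lipton world; only the uniform fixed-algorithm version in print, BKO20 App. A
[corpus:paper:arxiv-1905.12935 p.16]); S-free ROAD U⁺ ⟹ A⁺ (kernel `dark_of_road`; aside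
NoS12ProofOfNPinPpoly); ABOVE N1's U modulo N1's necessity edge S ⟹ U (kernel `u_of_dark`); leaf
IDEA-NEEDED · LOCATED (AM26's central open question) · PROGRAM-BACKED (ABM23/AM26/BKO20/CLO24
unprovability programme). BC5 rung PLAN-ONLY: the decided rung (S₂¹, EXP) of Y's lattice [AM26 p.3
L86–88] needs definition request D1 (bussCircuitEval) to -/
@[route_item "route-PneNP-RootDecompAdviceProvability"]
def AdviceDarkForS12 : Prop :=
  ¬ PneNP → ¬ (∀ φ : FirstOrder.Language.boundedArith.Formula (Fin 2), Literature.Computability.MetaComplexity.IsSigmab 1 φ → ∃ (χ₁ χ₂ : FirstOrder.Language.boundedArith.Formula (Fin 2)) (t : FirstOrder.Language.boundedArith.Term (Fin 1)), Literature.Computability.MetaComplexity.IsSigmab 1 χ₁ ∧ Literature.Computability.MetaComplexity.IsPib 1 χ₂ ∧ (Literature.Computability.MetaComplexity.S2 1 ⊨ᵇ FirstOrder.Language.BoundedFormula.iff χ₁ χ₂) ∧ (Literature.Computability.MetaComplexity.S2 1 ⊨ᵇ FirstOrder.Language.BoundedFormula.imp (FirstOrder.Language.Term.le (FirstOrder.Language.Term.var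 (Sum.inl 1)) (FirstOrder.Language.Term.var (Sum.inl 0))) (Literature.Computability.MetaComplexity.bexLE (t.relabel fun _ => (Sum.inl 0 : Fin 2 ⊕ Fin 0)) (Literature.Computability.MetaComplexity.ballLE (FirstOrder.Language.Term.var (Sum.inl 0)) (FirstOrder.Language.BoundedFormula.iff (FirstOrder.Language.BoundedFormula.relabel ![Sum.inr 1, Sum.inl 1] φ : FirstOrder.Language.boundedArith.BoundedFormula (Fin 2) 2) (FirstOrder.Language.BoundedFormula.relabel ![Sum.inr 1, Sum.inr 0] χ₁ : FirstOrder.Language.boundedArith.BoundedFormula (Fin 2) 2))))))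

/-- item stmt-PneNP-28071 · crux · rank 3 · open · by planner
why it might fail: Cannot fail more than N1's residual pair does (kernel edge); stand-alone it asserts that EVERY P = NP world is Karp–Lipton-provable in S₂¹ — false in any DeMillo–Lipton-type model of S₂¹ + P = NP + ¬«NP ⊆ P/poly provably», none known (BKO20 App. A has only the fixed-algorithm uniform version).
sources: arXiv:1905.12935, doi:10.2178/jsl/1203350791, Krajicek1995, arXiv:2604.25251
[crux] R⁻ (lens PIECE R⁻, the DECLARED RESIDUAL): if P = NP then S₂¹ PROVES «NP ⊆ P/poly» in advice
form (provably-Δᵇ₁ relation + term-bounded advice) — ¬S → ProvNPinPpoly, verbatim. Tags: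
DECLARED-RESIDUAL · S-implied (law D recorded, not hidden: kernel `collapseProvable_of_summit`) · «≤
N1's residual pair» PROVED in kernel (`collapseProvable_of_record : ProverIsProvable
(stmt-PneNP-26832) → CollapseReachesEF (stmt-PneNP-17354) → R⁻`, and `AdviceCollapseIsProvable_of :
(U → S) → R⁻` = the BC3 strengthen-to-record line) · converse UNKNOWN (S₂¹ ⊢ NP ⊆ P/poly gives PH ⊆
P^NP_tt by Cook–Krajíček 2007 doi:10.2178/jsl/1203350791 but no S₂¹-certified SAT algorithm) ⇒
critic rule (v): BOOKED «residual candidate of the proof-complexity chain: ≤ proved, < undecided»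
(stated test: «S₂¹ ⊢ NP ⊆ P/poly ⟹ ∃ e k, S₂¹ ⊢ Dec(e,k)?»; becomes the chain's residual of record
on a separating-world note from the census, else stays tied with N1's pair); zero-sum honesty: given
U⁺, R⁻ ⟺ S; given ¬U⁺, A⁺ ⟺ S (lens probes R_is_S_given_Up / A_is_S_given_notUp). [deps:
AdviceDarkForS12] [difficulty: open-problem] -/
@[route_item "route-PneNP-RootDecompAdviceProvability"]
def AdviceCollapseIsProvable : Prop :=
  ¬ PneNP → (∀ φ : FirstOrder.Language.boundedArith.Formula (Fin 2), Literature.Computability.MetaComplexity.IsSigmab 1 φ → ∃ (χ₁ χ₂ : FirstOrder.Language.boundedArith.Formula (Fin 2)) (t : FirstOrder.Language.boundedArith.Term (Fin 1)), Literature.Computability.MetaComplexity.IsSigmab 1 χ₁ ∧ Literature.Computability.MetaComplexity.IsPib 1 χ₂ ∧ (Literature.Computability.MetaComplexity.S2 1 ⊨ᵇ FirstOrder.Language.BoundedFormula.iff χ₁ χ₂) ∧ (Literature.Computability.MetaComplexity.S2 1 ⊨ᵇ FirstOrder.Language.BoundedFormula.imp (FirstOrder.Language.Term.le (FirstOrder.Language.Term.var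 (Sum.inl 1)) (FirstOrder.Language.Term.var (Sum.inl 0))) (Literature.Computability.MetaComplexity.bexLE (t.relabel fun _ => (Sum.inl 0 : Fin 2 ⊕ Fin 0)) (Literature.Computability.MetaComplexity.ballLE (FirstOrder.Language.Term.var (Sum.inl 0)) (FirstOrder.Language.BoundedFormula.iff (FirstOrder.Language.BoundedFormula.relabel ![Sum.inr 1, Sum.inl 1] φ : FirstOrder.Language.boundedArith.BoundedFormula (Fin 2) 2) (FirstOrder.Language.BoundedFormula.relabel ![Sum.inr 1, Sum.inr 0] χ₁ : FirstOrder.Language.boundedArith.BoundedFormula (Fin 2) 2))))))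

/-- item stmt-PneNP-28072 · aside · rank 9 · open · by planner
sources: arXiv:2604.25251, arXiv:2303.01016, arXiv:1905.12935, doi:10.1016/0168-0072(91)90043-l
[support] (filed kind ASIDE — the ROAD U⁺, INCOMPARABLE with S (probes U⁺ → S and S → U⁺ fail;
precedents N7-26297, lens-4 τ-road), never in the cone of `closes` until a registered skeleton of A⁺
names it as stub) «S₂¹ does not prove NP ⊆ P/poly in advice form (provably-Δᵇ₁ relation +
term-bounded advice)» = ¬ProvNPinPpoly — the literature's central open question of bounded
arithmetic w.r.t. circuit lower bounds [corpus:paper:arxiv-2604.25251 p.3 L27–29;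
corpus:paper:arxiv-2303.01016 p.3]; U⁺ ⟹ A⁺ (kernel `dark_of_road`), U⁺ ∧ R⁻ ⟹ S (`closes_of_road`);
decided rungs of Y's lattice in print: (V₂⁰, NEXP) ABM23, (S₂¹, EXP) AM26 via Takeuti, fixed-k
BKO20/KO17, relativised KPT91 TRUE; in-print meta-ceiling «Gödel-type consistency statements do not
seem to reach very far … new methods seem to be required» [corpus:paper:arxiv-2604.25251 p.3
L52–57]; every other printed road to U⁺ (NP ⊄ P/poly, PH ⊄ P^NP_tt, coNP ⊄ NP/O(log n)) is ≥ S. Kill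
= a proof of ProvNPinPpoly. One click further (record only, not filed): U⁺⁺ «S₂¹ ⊬ NP ⊆ coNP/poly»
with kernel U⁺⁺ ⟹ U⁺ (lens Part IV); top calibration «S₂¹ ⊢ NP ⊆ NP/poly» PROVED in kernel (lens
`provNPinNPpoly_holds`). [difficulty: open-problem] -/
@[route_item "route-PneNP-RootDecompAdviceProvability"]
def NoS12ProofOfNPinPpoly : Prop :=
  ¬ (∀ φ : FirstOrder.Language.boundedArith.Formula (Fin 2), Literature.Computability.MetaComplexity.IsSigmab 1 φ → ∃ (χ₁ χ₂ : FirstOrder.Language.boundedArith.Formula (Fin 2)) (t : FirstOrder.Language.boundedArith.Term (Fin 1)), Literature.Computability.MetaComplexity.IsSigmab 1 χ₁ ∧ Literature.Computability.MetaComplexity.IsPib 1 χ₂ ∧ (Literature.Computability.MetaComplexity.S2 1 ⊨ᵇ FirstOrder.Language.BoundedFormula.iff χ₁ χ₂) ∧ (Literature.Computability.MetaComplexity.S2 1 ⊨ᵇ FirstOrder.Language.BoundedFormula.imp (FirstOrder.Language.Term.le (FirstOrder.Language.Term.var (Sum.inl 1)) (FirstOrder.Language.Term.var (Sum.inl 0)))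 (Literature.Computability.MetaComplexity.bexLE (t.relabel fun _ => (Sum.inl 0 : Fin 2 ⊕ Fin 0)) (Literature.Computability.MetaComplexity.ballLE (FirstOrder.Language.Term.var (Sum.inl 0)) (FirstOrder.Language.BoundedFormula.iff (FirstOrder.Language.BoundedFormula.relabel ![Sum.inr 1, Sum.inl 1] φ : FirstOrder.Language.boundedArith.BoundedFormula (Fin 2) 2) (FirstOrder.Language.BoundedFormula.relabel ![Sum.inr 1, Sum.inr 0] χ₁ : FirstOrder.Language.boundedArith.BoundedFormula (Fin 2) 2))))))

/-- item stmt-PneNP-28073 · aside · rank 9 · closed · proved by Summit.PneNP.PneNP.Theorems.uPlusImpliesU_proof (prover) · by planner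
sources: Krajicek1995, arXiv:2604.25251
[support] (filed kind ASIDE, SUPPORT-DESIGNATE, PROVABLE NOW — kernel `uPlusImpliesU_holds` in
bc/N12_items.lean = lens `noS12ProofOfNPeqCoNP_of_uPlus`, ~15 lines: provable NP = coNP ⟹ provable
NP ⊆ P/poly with empty advice; the dummy bounded parameter b ≤ n makes the edge relabel-free) the
edge placing the road under N1: U⁺ ⟹ U, where U = stmt-PneNP-26831 NoS12ProofOfNPeqCoNP «S₂¹ ⊬ NP =
coNP» (text verbatim = route-PneNP-RootDecompEfProver decl, certified `u_text_iff_tree : … :=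
Iff.rfl`). Port target: Theorems/RootDecompAdviceProvability/UPlusImpliesU.lean by any idle prover.
[difficulty: provable-now] -/
@[route_item "route-PneNP-RootDecompAdviceProvability"]
def UPlusImpliesU : Prop :=
  (¬ (∀ φ : FirstOrder.Language.boundedArith.Formula (Fin 2), Literature.Computability.MetaComplexity.IsSigmab 1 φ → ∃ (χ₁ χ₂ : FirstOrder.Language.boundedArith.Formula (Fin 2)) (t : FirstOrder.Language.boundedArith.Term (Fin 1)), Literature.Computability.MetaComplexity.IsSigmab 1 χ₁ ∧ Literature.Computability.MetaComplexity.IsPib 1 χ₂ ∧ (Literature.Computability.MetaComplexity.S2 1 ⊨ᵇ FirstOrder.Language.BoundedFormula.iff χ₁ χ₂) ∧ (Literature.Computability.MetaComplexity.S2 1 ⊨ᵇ FirstOrder.Language.BoundedFormula.imp (FirstOrder.Language.Term.le (FirstOrder.Language.Term.var (Sum.inl 1)) (FirstOrder.Language.Term.var (Sum.inl 0))) (Literature.Computability.MetaComplexity.bexLE (t.relabel fun _ => (Sum.inl 0 : Fin 2 ⊕ Fin 0)) (Literature.Computability.MetaComplexity.ballLE (FirstOrder.Language.Term.var (Sum.inl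 0)) (FirstOrder.Language.BoundedFormula.iff (FirstOrder.Language.BoundedFormula.relabel ![Sum.inr 1, Sum.inl 1] φ : FirstOrder.Language.boundedArith.BoundedFormula (Fin 2) 2) (FirstOrder.Language.BoundedFormula.relabel ![Sum.inr 1, Sum.inr 0] χ₁ : FirstOrder.Language.boundedArith.BoundedFormula (Fin 2) 2))))))) → (∃ (k : ℕ) (ψ : FirstOrder.Language.boundedArith.Formula (Fin k)), Literature.Computability.MetaComplexity.IsPib 1 ψ ∧ ∀ χ : FirstOrder.Language.boundedArith.Formula (Fin k), Literature.Computability.MetaComplexity.IsSigmab 1 χ → ¬ (Literature.Computability.MetaComplexity.S2 1 ⊨ᵇ FirstOrder.Language.BoundedFormula.iff ψ χ))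

-- `UPlusImpliesU` holds: proved by `Summit.PneNP.PneNP.Theorems.uPlusImpliesU_proof` (its module imports this route file, so no `_holds` link can be stated here).

/-- item stmt-PneNP-28074 · assembly · rank 1 · open · by planner
sources: Krajicek1995
[assembly] AdviceDarkForS12 → AdviceCollapseIsProvable → P ≠ NP. -/
@[route_item "route-PneNP-RootDecompAdviceProvability"]
def Assembly : Prop :=
  AdviceDarkForS12 → AdviceCollapseIsProvable → PneNP

/-! D-0027 §2.1 — DECIDING THEOREM (planner-authored via `route open/edit --closes-file`; by planner-decomp-pnenp-writer-1-g3-0 2026-08-30T04:49:40Z):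
its hypotheses are this route's items and its conclusion the sub-problem Statement (glue_lint), and it elaborates with this file. -/

@[closes "route-PneNP-RootDecompAdviceProvability"] theorem closes (hA : AdviceDarkForS12) (hR : AdviceCollapseIsProvable) : _root_.PneNP := by
  by_contra hS
  exact hA hS (hR hS)

end Summit.PneNP.PneNP.Theses.RootDecompAdviceProvability
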